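import Mathlib
import Summits.NavierStokesRegularity.NavierStokesRegularity.Theorems.WakeRatchetTailRatchetPostFiringEnergy
import HarnessLib

/-!
# `WakeRatchet.TailRatchet` (stmt-NavierStokesRegularity-21808), door D4′ — UNCONDITIONAL firing clock and the
# super-exponential LEADING EDGE ahead of the firing front

Def-free support lemmas (MODEL lattice ODEs: the scalar dyadic member of Tao 2016 §1.2 / §4 in the renormalised
variables of §6.4; nothing here concerns the Navier–Stokes equations; stmt-21808 is neither proved nor refuted here
and no stub of skeleton d00b85951d7c is closed).

SETTING (as in `WakeRatchetTailRatchetPostFiringClock`): `W : ℤ → ℝ → ℝ` solves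
`W_n' = −W_n + Λ W_{n−1}² − Λ⁻¹ W_n W_{n+1}` on `σ > A₀`, `0 ≤ W ≤ B` on `σ ≥ A > A₀`, quiet start (`W_n ≡ 0` for
`n < 0`, `W_n(A) = 0` for `n > 0`), lower rate at level `c > 0` with `Λc ≤ 1`.

* `firingSet_nonempty_of_energy`, `exists_firstFiring_of_energy` — EVERY SHELL FIRES and the first-firing clock
  `s` exists, WITHOUT the post-firing hypothesis (D′) used for this in `WakeRatchetTailRatchetPostFiringClock`
  (`firingSet_nonempty_le`, `exists_firstFiring`): by the energy line (`energy_line`, Λ > 1) all shells `≤ k` are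
  below `c` at a late enough log-time, the lower rate then lights a shell `> k`, and the firing order
  (`exists_fired_below`) brings the level `c` down to shell `k`.  So the clock of door D4′ is unconditional; only
  the GAP bound needs (D′).
* `leadingEdge_Icc` / `leadingEdge` — **the leading edge is doubly exponentially small, unconditionally**: with the
  first-firing clock `s` (monotone), for every `N, i ∈ ℕ` and every log-time `σ ∈ [s_N, s_{N+1})`:
  `W_{N+1+i}(σ) ≤ Λ⁻¹ (Λc)^{2^i}` (levels `c, Λc², Λ³c⁴, …`; induction on `N` with the tree's invariant level
  `le_level_of_feed_sq_le`: the level sequence `L_{i+1} = Λ L_i²` is invariant between firings and only improves when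
  the front advances).  Any n-uniform wake estimate ((D)/(QT)) can therefore take the profile AHEAD of the front as
  known; together with the energy line (deep wake) the open content of door D4′ is confined to the band between the
  energy line and the front (census CENSUS-21808-leafhand4-g17.md).

HONEST FRAMING: elementary real analysis; (D)/(QT) are NOT proved here; rung 0.
-/

noncomputable section

set_option linter.dupNamespace false

namespace Summit.NavierStokesRegularity.NavierStokesRegularity.Theorems

namespace WakeRatchetDyadicPostFiring

open Set Filter Topology
open WakeRatchetFiringClock

variable {Λ : ℝ} {W : ℤ → ℝ → ℝ} {A₀ A B c : ℝ}

/-! ## Every shell fires — from the energy line, without (D′) -/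

/-- **Every shell `k ≥ 0` reaches the level `c`** (no post-firing hypothesis): at the log-time
`σ = σ₁ + X/c + 1`, `σ₁ = A + 1`, `X = Λ^k e^{−σ₁} √E(σ₁)`, the energy line puts all shells `m ≤ k` strictly below
`c`; the lower rate lights some shell, necessarily of index `> k`, and the iterated firing order brings level `c`
down to shell `k` at an earlier log-time.
[cite: Tao2016AveragedNS, §1.2 (dyadic model: conserved energy), §4 Lemma 4.1 (4.8)/(4.10), §6.4; elementary] -/
theorem firingSet_nonempty_of_energy (hΛ : 1 < Λ) (hA : A₀ < A) (hc : 0 < c) (hΛc : Λ * c ≤ 1)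
    (hlaw : ∀ (n : ℤ) (σ : ℝ), A₀ < σ → HasDerivAt (W n)
      (-(W n σ) + Λ * W (n - 1) σ ^ 2 - Λ⁻¹ * W n σ * W (n + 1) σ) σ)
    (hnn : ∀ (n : ℤ) (σ : ℝ), A ≤ σ → 0 ≤ W n σ) (hB : ∀ (n : ℤ) (σ : ℝ), A ≤ σ → W n σ ≤ B)
    (hneg : ∀ n : ℤ, n < 0 → ∀ σ : ℝ, A ≤ σ → W n σ = 0) (hstart : ∀ n : ℤ, 0 < n → W n A = 0)
    (hrate : ∀ σ : ℝ, A ≤ σ → ∃ n : ℤ, c ≤ W n σ) (k : ℕ) :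
    {σ : ℝ | A ≤ σ ∧ c ≤ W (k : ℤ) σ}.Nonempty := by
  have hΛ0 : 0 < Λ := by linarith
  set σ₁ : ℝ := A + 1 with hσ₁
  have hσ₁A : A < σ₁ := by rw [hσ₁]; linarith
  set E₁ : ℝ := ∑' j : ℕ, Λ⁻¹ ^ (2 * j) * (Real.exp (2 * σ₁) * W j σ₁ ^ 2) with hE₁
  set X : ℝ := Λ ^ k * Real.exp (-σ₁) * Real.sqrt E₁ with hX
  have hX0 : 0 ≤ X := by positivity
  set σ : ℝ := σ₁ + (X / c + 1) with hσdef
  have hσσ₁ : σ₁ ≤ σ := by rw [hσdef]; have := div_nonneg hX0 hc.le; linarith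
  have hσA : A ≤ σ := hσ₁A.le.trans hσσ₁
  -- all shells `m ≤ k` are strictly below `c` at `σ`
  have hquiet : ∀ m : ℕ, m ≤ k → W (m : ℤ) σ < c := by
    intro m hm
    have hline := energy_line hΛ hA hlaw hnn hB hneg hσ₁A hσσ₁ m
    have hpow : Λ ^ m ≤ Λ ^ k := pow_le_pow_right₀ hΛ.le hm
    have hexp : Real.exp (-σ) * (1 + (X / c + 1)) ≤ Real.exp (-σ₁) := by
      have h1 : 1 + (X / c + 1) ≤ Real.exp (X / c + 1) := by
        have := Real.add_one_le_exp (X / c + 1); linarith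
      have h2 : Real.exp (-σ) * Real.exp (X / c + 1) = Real.exp (-σ₁) := by
        rw [← Real.exp_add]; congr 1; rw [hσdef]; ring
      calc Real.exp (-σ) * (1 + (X / c + 1)) ≤ Real.exp (-σ) * Real.exp (X / c + 1) :=
            mul_le_mul_of_nonneg_left h1 (Real.exp_pos _).le
        _ = Real.exp (-σ₁) := h2
    have hden : 0 < 1 + (X / c + 1) := by have := div_nonneg hX0 hc.le; linarith
    -- `Λ^k e^{−σ} √E₁ ≤ X/(2 + X/c) < c`
    have hbound : Λ ^ k * Real.exp (-σ) * Real.sqrt E₁ * (1 + (X / c + 1)) ≤ X := by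
      calc Λ ^ k * Real.exp (-σ) * Real.sqrt E₁ * (1 + (X / c + 1))
          = Λ ^ k * Real.sqrt E₁ * (Real.exp (-σ) * (1 + (X / c + 1))) := by ring
        _ ≤ Λ ^ k * Real.sqrt E₁ * Real.exp (-σ₁) := mul_le_mul_of_nonneg_left hexp (by positivity)
        _ = X := by rw [hX]; ring
    have hXlt : X < c * (1 + (X / c + 1)) := by
      have : c * (1 + (X / c + 1)) = 2 * c + X := by field_simp; ring
      rw [this]; linarith
    have hlt : Λ ^ k * Real.exp (-σ) * Real.sqrt E₁ < c := by
      by_contra hge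
      push Not at hge
      have := mul_le_mul_of_nonneg_right hge hden.le
      linarith
    calc W (m : ℤ) σ ≤ Λ ^ m * Real.exp (-σ) * Real.sqrt E₁ := hline
      _ ≤ Λ ^ k * Real.exp (-σ) * Real.sqrt E₁ := by gcongr
      _ < c := hlt
  -- the lower rate lights a shell of index `> k`
  obtain ⟨n, hn⟩ := hrate σ hσA
  have hn0 : 0 ≤ n := nonneg_of_fire hc hneg hσA hn
  obtain ⟨d', hd'⟩ : ∃ d' : ℕ, (d' : ℤ) = n := ⟨n.toNat, Int.toNat_of_nonneg hn0⟩
  have hkd : k < d' := by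
    by_contra hle
    push Not at hle
    have := hquiet d' hle
    rw [hd'] at this
    linarith
  obtain ⟨d, rfl⟩ : ∃ d : ℕ, d' = k + d := ⟨d' - k, by omega⟩
  rw [← hd'] at hn
  obtain ⟨τ, hτA, -, hτc⟩ := exists_fired_below hΛ0 hA hc hΛc hlaw hnn hstart k d hσA hn
  exact ⟨τ, hτA, hτc⟩

/-- **First firing log-times, unconditionally.**  `s n = inf {σ ≥ A : W_n(σ) ≥ c}` exists for every `n ≥ 0`, is
`≥ A`, is attained, and is minimal — the conclusion of `exists_firstFiring` WITHOUT its hypothesis (D′)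
(needs `Λ > 1` and the uniform bound instead, through the energy line).
[cite: Tao2016AveragedNS, §1.2, §4 Lemma 4.1 (4.8)/(4.10), §6.4; elementary] -/
theorem exists_firstFiring_of_energy (hΛ : 1 < Λ) (hA : A₀ < A) (hc : 0 < c) (hΛc : Λ * c ≤ 1)
    (hlaw : ∀ (n : ℤ) (σ : ℝ), A₀ < σ → HasDerivAt (W n)
      (-(W n σ) + Λ * W (n - 1) σ ^ 2 - Λ⁻¹ * W n σ * W (n + 1) σ) σ)
    (hnn : ∀ (n : ℤ) (σ : ℝ), A ≤ σ → 0 ≤ W n σ) (hB : ∀ (n : ℤ) (σ : ℝ), A ≤ σ → W n σ ≤ B)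
    (hneg : ∀ n : ℤ, n < 0 → ∀ σ : ℝ, A ≤ σ → W n σ = 0) (hstart : ∀ n : ℤ, 0 < n → W n A = 0)
    (hrate : ∀ σ : ℝ, A ≤ σ → ∃ n : ℤ, c ≤ W n σ) :
    ∃ s : ℕ → ℝ, (∀ n : ℕ, A ≤ s n) ∧ (∀ n : ℕ, c ≤ W n (s n)) ∧
      (∀ (n : ℕ) (σ : ℝ), A ≤ σ → c ≤ W (n : ℤ) σ → s n ≤ σ) := by
  refine ⟨fun n => sInf {σ : ℝ | A ≤ σ ∧ c ≤ W (n : ℤ) σ}, fun n => ?_, fun n => ?_,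
    fun n σ hσ h => sInf_firingSet_le (n : ℤ) hσ h⟩
  · exact ((isClosed_firingSet hA hlaw (n : ℤ)).csInf_mem
      (firingSet_nonempty_of_energy hΛ hA hc hΛc hlaw hnn hB hneg hstart hrate n)
      (bddBelow_firingSet (n : ℤ))).1
  · exact ((isClosed_firingSet hA hlaw (n : ℤ)).csInf_mem
      (firingSet_nonempty_of_energy hΛ hA hc hΛc hlaw hnn hB hneg hstart hrate n)
      (bddBelow_firingSet (n : ℤ))).2

/-! ## The leading edge ahead of the firing front -/

/-- The level sequence `L_i = Λ⁻¹(Λc)^{2^i}` obeys `L_0 = c` and `Λ L_i² = L_{i+1}`. [elementary] -/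
theorem leadingLevel_succ (hΛ : 0 < Λ) (c : ℝ) (i : ℕ) :
    Λ * (Λ⁻¹ * (Λ * c) ^ (2 ^ i)) ^ 2 = Λ⁻¹ * (Λ * c) ^ (2 ^ (i + 1)) := by
  have hX : (Λ * c) ^ (2 ^ (i + 1)) = ((Λ * c) ^ (2 ^ i)) ^ 2 := by rw [pow_succ, pow_mul]
  rw [hX]
  calc Λ * (Λ⁻¹ * (Λ * c) ^ (2 ^ i)) ^ 2 = (Λ * Λ⁻¹) * (Λ⁻¹ * ((Λ * c) ^ (2 ^ i)) ^ 2) := by ring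
    _ = Λ⁻¹ * ((Λ * c) ^ (2 ^ i)) ^ 2 := by rw [mul_inv_cancel₀ hΛ.ne', one_mul]

/-- The level sequence is non-increasing when `0 ≤ Λc ≤ 1`. [elementary] -/
theorem leadingLevel_succ_le (hΛ : 0 < Λ) (hc : 0 ≤ c) (hΛc : Λ * c ≤ 1) (i : ℕ) :
    Λ⁻¹ * (Λ * c) ^ (2 ^ (i + 1)) ≤ Λ⁻¹ * (Λ * c) ^ (2 ^ i) := by
  have hΛi : 0 ≤ Λ⁻¹ := (inv_pos.2 hΛ).le
  refine mul_le_mul_of_nonneg_left ?_ hΛi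
  exact pow_le_pow_of_le_one (by positivity) hΛc (Nat.pow_le_pow_right (by norm_num) (Nat.le_succ i))

/-- **LEADING EDGE (closed windows).**  With the first-firing clock `s` (at level `c`, `Λc ≤ 1`, quiet start): for
every `N ∈ ℕ`, (i) `W_{N+1}(σ) ≤ c` for `σ ∈ [s_N, s_{N+1})`, and (ii) for every `i ≥ 1` and `σ ∈ [s_N, s_{N+1}]`:
`W_{N+1+i}(σ) ≤ Λ⁻¹(Λc)^{2^i}`.  (Induction on `N`; within a window the level `L_{i+1} = ΛL_i²` of shell `N+2+i`
is invariant by `le_level_of_feed_sq_le` because its feed `W_{N+1+i}` stays `≤ L_i`; at a firing the window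
shifts and the inherited bound `L_{i+1} ≤ L_i` only improves.)
[cite: Tao2016AveragedNS, §1.2, §4 Lemma 4.1 (4.8), §6.4; elementary] -/
theorem leadingEdge_Icc (hΛ : 0 < Λ) (hA : A₀ < A) (hc : 0 < c) (hΛc : Λ * c ≤ 1)
    (hlaw : ∀ (n : ℤ) (σ : ℝ), A₀ < σ → HasDerivAt (W n)
      (-(W n σ) + Λ * W (n - 1) σ ^ 2 - Λ⁻¹ * W n σ * W (n + 1) σ) σ)
    (hnn : ∀ (n : ℤ) (σ : ℝ), A ≤ σ → 0 ≤ W n σ)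
    (hneg : ∀ n : ℤ, n < 0 → ∀ σ : ℝ, A ≤ σ → W n σ = 0) (hstart : ∀ n : ℤ, 0 < n → W n A = 0)
    (hrate : ∀ σ : ℝ, A ≤ σ → ∃ n : ℤ, c ≤ W n σ)
    {s : ℕ → ℝ} (hs1 : ∀ n : ℕ, A ≤ s n)
    (hs3 : ∀ (n : ℕ) (σ : ℝ), A ≤ σ → c ≤ W (n : ℤ) σ → s n ≤ σ) (hmono : Monotone s) (N : ℕ) :
    (∀ σ ∈ Ico (s N) (s (N + 1)), W ((N : ℤ) + 1) σ ≤ c) ∧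
    (∀ i : ℕ, 1 ≤ i → ∀ σ ∈ Icc (s N) (s (N + 1)), W ((N : ℤ) + 1 + i) σ ≤ Λ⁻¹ * (Λ * c) ^ (2 ^ i)) := by
  -- (i) holds in every window, by minimality of `s (N+1)`
  have hfirst : ∀ M : ℕ, ∀ σ ∈ Ico (s M) (s (M + 1)), W ((M : ℤ) + 1) σ ≤ c := by
    intro M σ hσ
    by_contra h
    push Not at h
    have hσA : A ≤ σ := (hs1 M).trans hσ.1
    have := hs3 (M + 1) σ hσA (by push_cast; exact h.le)
    exact absurd hσ.2 (not_lt.2 this)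
  -- the inner induction on `i`, given initial values at the left end of the window
  have hwindow : ∀ M : ℕ,
      (∀ i : ℕ, 1 ≤ i → W ((M : ℤ) + 1 + i) (s M) ≤ Λ⁻¹ * (Λ * c) ^ (2 ^ i)) →
      ∀ i : ℕ, 1 ≤ i → ∀ σ ∈ Icc (s M) (s (M + 1)), W ((M : ℤ) + 1 + i) σ ≤ Λ⁻¹ * (Λ * c) ^ (2 ^ i) := by
    intro M hinit i
    induction i with
    | zero => intro h; exact absurd h (by norm_num)
    | succ i ih =>
      intro _ σ hσ
      have hsA : A ≤ s M := hs1 M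
      -- feed bound on `Ico`: shell `M+1+i` is `≤ L_i` (case `i = 0` from (i), else from `ih`)
      have hfeed : ∀ τ ∈ Ico (s M) (s (M + 1)), W ((M : ℤ) + 1 + i) τ ^ 2 ≤ (Λ⁻¹ * (Λ * c) ^ (2 ^ i)) ^ 2 := by
        intro τ hτ
        have h0 : 0 ≤ W ((M : ℤ) + 1 + i) τ := hnn _ τ (hsA.trans hτ.1)
        refine pow_le_pow_left₀ h0 ?_ 2
        rcases Nat.eq_zero_or_pos i with hi | hi
        · subst hi
          have h := hfirst M τ hτ
          have e : Λ⁻¹ * (Λ * c) ^ (2 ^ 0) = c := by rw [pow_zero, pow_one]; field_simp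
          rw [e]; simpa using h
        · exact ih hi τ ⟨hτ.1, hτ.2.le⟩
      -- the row of shell `M+2+i`
      have hv : ∀ τ ∈ Ico (s M) (s (M + 1)), HasDerivAt (W ((M : ℤ) + 1 + (i + 1 : ℕ)))
          (-(W ((M : ℤ) + 1 + (i + 1 : ℕ)) τ) + Λ * W ((M : ℤ) + 1 + i) τ ^ 2
            - Λ⁻¹ * W ((M : ℤ) + 1 + (i + 1 : ℕ)) τ * W ((M : ℤ) + 1 + (i + 1 : ℕ) + 1) τ) τ := by
        intro τ hτ
        have h := hlaw ((M : ℤ) + 1 + (i + 1 : ℕ)) τ (hA.trans_le (hsA.trans hτ.1))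
        have e : (M : ℤ) + 1 + ((i + 1 : ℕ) : ℤ) - 1 = (M : ℤ) + 1 + (i : ℤ) := by push_cast; ring
        rwa [e] at h
      have hvc : ContinuousOn (W ((M : ℤ) + 1 + (i + 1 : ℕ))) (Icc (s M) (s (M + 1))) :=
        continuousOn_Icc hlaw _ (hA.trans_le hsA)
      have hv0 : ∀ τ ∈ Icc (s M) (s (M + 1)), 0 ≤ W ((M : ℤ) + 1 + (i + 1 : ℕ)) τ :=
        fun τ hτ => hnn _ τ (hsA.trans hτ.1)
      have hz0 : ∀ τ ∈ Icc (s M) (s (M + 1)), 0 ≤ W ((M : ℤ) + 1 + (i + 1 : ℕ) + 1) τ :=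
        fun τ hτ => hnn _ τ (hsA.trans hτ.1)
      have hinit' : W ((M : ℤ) + 1 + (i + 1 : ℕ)) (s M) ≤ Λ * (Λ⁻¹ * (Λ * c) ^ (2 ^ i)) ^ 2 := by
        rw [leadingLevel_succ hΛ c i]
        exact hinit (i + 1) (by omega)
      have h := le_level_of_feed_sq_le hΛ hv hvc hv0 hz0 hfeed hinit' σ hσ
      rwa [leadingLevel_succ hΛ c i] at h
  -- the outer induction on the window index
  induction N with
  | zero =>
    refine ⟨hfirst 0, hwindow 0 fun i hi => ?_⟩
    have hs0 : s 0 = A := firstFiring_zero hc hneg hstart hrate hs1 hs3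
    rw [hs0, show ((0 : ℕ) : ℤ) + 1 + (i : ℤ) = ((i + 1 : ℕ) : ℤ) by push_cast; ring,
      hstart _ (by exact_mod_cast Nat.succ_pos i)]
    have hΛi : 0 ≤ Λ⁻¹ := (inv_pos.2 hΛ).le
    positivity
  | succ N ih =>
    refine ⟨hfirst (N + 1), hwindow (N + 1) fun i hi => ?_⟩
    -- inherited from the previous window at its right end: shell `(N+1)+1+i = N+1+(i+1)` is `≤ L_{i+1} ≤ L_i`
    have hmem : s (N + 1) ∈ Icc (s N) (s (N + 1)) := ⟨hmono (Nat.le_succ N), le_rfl⟩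
    have h := ih.2 (i + 1) (by omega) (s (N + 1)) hmem
    have e : ((N + 1 : ℕ) : ℤ) + 1 + (i : ℤ) = (N : ℤ) + 1 + ((i + 1 : ℕ) : ℤ) := by push_cast; ring
    rw [e]
    exact h.trans (leadingLevel_succ_le hΛ hc.le hΛc i)

/-- **LEADING EDGE.**  With the first-firing clock `s` (level `c`, `Λc ≤ 1`, quiet start, lower rate): for all
`N, i ∈ ℕ` and all `σ ∈ [s_N, s_{N+1})`, `W_{N+1+i}(σ) ≤ Λ⁻¹ (Λc)^{2^i}` — ahead of the firing front the
renormalised profile is below the doubly exponential envelope `c, Λc², Λ³c⁴, …`, uniformly in `N`.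
[cite: Tao2016AveragedNS, §1.2, §4 Lemma 4.1 (4.8), §6.4; elementary] -/
theorem leadingEdge (hΛ : 0 < Λ) (hA : A₀ < A) (hc : 0 < c) (hΛc : Λ * c ≤ 1)
    (hlaw : ∀ (n : ℤ) (σ : ℝ), A₀ < σ → HasDerivAt (W n)
      (-(W n σ) + Λ * W (n - 1) σ ^ 2 - Λ⁻¹ * W n σ * W (n + 1) σ) σ)
    (hnn : ∀ (n : ℤ) (σ : ℝ), A ≤ σ → 0 ≤ W n σ)
    (hneg : ∀ n : ℤ, n < 0 → ∀ σ : ℝ, A ≤ σ → W n σ = 0) (hstart : ∀ n : ℤ, 0 < n → W n A = 0)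
    (hrate : ∀ σ : ℝ, A ≤ σ → ∃ n : ℤ, c ≤ W n σ)
    {s : ℕ → ℝ} (hs1 : ∀ n : ℕ, A ≤ s n)
    (hs3 : ∀ (n : ℕ) (σ : ℝ), A ≤ σ → c ≤ W (n : ℤ) σ → s n ≤ σ) (hmono : Monotone s)
    (N i : ℕ) {σ : ℝ} (hσ : σ ∈ Ico (s N) (s (N + 1))) :
    W ((N : ℤ) + 1 + i) σ ≤ Λ⁻¹ * (Λ * c) ^ (2 ^ i) := by
  obtain ⟨h1, h2⟩ := leadingEdge_Icc hΛ hA hc hΛc hlaw hnn hneg hstart hrate hs1 hs3 hmono N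
  rcases Nat.eq_zero_or_pos i with hi | hi
  · subst hi
    have e : Λ⁻¹ * (Λ * c) ^ (2 ^ 0) = c := by rw [pow_zero, pow_one]; field_simp
    rw [e]
    simpa using h1 σ hσ
  · exact h2 i hi σ ⟨hσ.1, hσ.2.le⟩

end WakeRatchetDyadicPostFiring

end Summit.NavierStokesRegularity.NavierStokesRegularity.Theorems

end
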